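import Literature.AlgebraicGeometry.Frobenioids.CoAngular
import Literature.AlgebraicGeometry.Frobenioids.PreFrobenioidDataOfFunctor
import Literature.AlgebraicGeometry.Frobenioids.DivisorMonoidCategoryTheoreticityDefs
import Literature.AlgebraicGeometry.Frobenioids.EquivalenceUnitsTransport
import HarnessLib

/-!
# Frobenioids I, Corollary 4.11 (i)/(iv) rigidity mechanism — "Div-rigidity" of `C → D` over a Div-slim
# base

Mochizuki, *The geometry of Frobenioids I: the general theory*, Kyushu J. Math. **62** (2008)
293–400, kurims text proof of Cor. 4.11 (i) p. 93: "if `α ∈ Aut(C_i → C_i^un-tr)`, then every automorphism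
induced by `α` is a Div-identity automorphism … the element `α_A ∈ Aut((C_i^pl-bk)_A → D_i) ⥲
Aut((D_i)_{A_D} → D_i)` determined by `α` maps to the identity element of `Aut((D_i)_{A_D} → Mon)`. Thus,
since `D_i` is Div-slim, it follows that every automorphism induced by `α` is a base-identity automorphism",
and (iv) p. 94 "the rigidity assertion follows via the same argument" [cite: MochizukiFrdI2008, Cor. 4.11 (i) p.93].

PROOF-ONLY. The Div-slim analogue of Prop. 1.13 (i) (`RigiditySlimness.lean`, seat abc-iut-L1-t1: for
SLIM `D` the functor `C → D` is rigid): for a Frobenioid `C → F_Φ` over a DIV-SLIM base (Def. 4.5 (iv),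
typed `PreFrobenioidData.IsDivSlim`), an automorphism of `C_A → C → D`, resp. of `C → D`, ALL OF WHOSE
COMPONENTS ACT TRIVIALLY ON `Φ` is trivial:

* `app_eq_id_of_iso_sliceBase_of_isDivSlim`: the heart — restrict along the equivalence
  `C^pl-bk_X ⥲ D_{X_D}` (Def. 1.3 (i)(c)), DESCEND to an automorphism of `D_{X_D} → D` (whiskering with an
  equivalence is fully faithful), check that it acts trivially on `Φ`, and apply Div-slimness;
* `baseFunctor_iso_eq_refl_of_isDivSlim`: "`C → D` is Div-rigid";
* `pull_eq_self_of_pull_div_eq` (Def. 1.3 (iii)(d): every `x ∈ Φ(A_D)` is a `Div(φ)`, `φ` out of `A`): it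
  suffices that the components fix the divisors of all arrows out of each object;
* `comp_baseFunctor_iso_eq_refl_of_isDivSlim`: the same for `Ψ ⋙ (C₂ → D₂)`, `Ψ : C₁ ⥲ C₂` an equivalence —
  the first clause of the typed `Cor411ivRigid` (v2) for Frobenioids, unconditionally.

No statement of the paper is strengthened; nothing here is specific to the abc programme.
-/

namespace Literature.AlgebraicGeometry.Frobenioids

open CategoryTheory Opposite

universe w v v' u u' v₁ u₁

namespace PreFrobenioid

variable {D : Type u} [Category.{v} D] {Φ : Dᵒᵖ ⥤ CommMonCat.{w}}
  {C : Type u'} [Category.{v'} C] {F : C ⥤ ElemFrobenioid Φ}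

/-- The heart of the Div-slim rigidity argument (FrdI proof of Cor. 4.11 (i) p. 93): for a Frobenioid over
a Div-slim base, an automorphism `α` of `C_A → C → D` all of whose components act trivially on the divisor
monoids is trivial. (Restrict `α` along `C^pl-bk_X → C_A`; by Def. 1.3 (i)(c) the result descends to an
automorphism of `D_{X_D} → D`, which acts trivially on `Φ`, hence is trivial by Div-slimness; evaluate at
`id_X`.) [cite: MochizukiFrdI2008, Cor. 4.11 (i) p.93] -/
theorem app_eq_id_of_iso_sliceBase_of_isDivSlim (hF : IsFrobenioid F)
    (hD : (PreFrobenioidData.ofFunctor Φ F).IsDivSlim) {A : C}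
    (α : Over.forget A ⋙ baseFunctor F ≅ Over.forget A ⋙ baseFunctor F)
    (hα : ∀ (U : Over A) (x : Φ.obj (op (baseObj F U.left))), Frobenioids.pull Φ (α.hom.app U) x = x)
    (U : Over A) : α.hom.app U = 𝟙 _ := by
  -- the induced automorphism `β` of `C^pl-bk_X → D_{X_D} → D`, `X := U.left` (as in Prop. 1.13 (i))
  let T := pullbackSliceToBase F U.left
  haveI : T.IsEquivalence := hF.i_c U.left
  let G := Over.forget ((wideSubcategoryInclusion (pullbackMorphisms F) ⋙ baseFunctor F).obj ⟨U.left⟩)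
  let toA : Over (⟨U.left⟩ : PullbackCat F) → Over A := fun W => Over.mk (W.hom.1 ≫ U.hom)
  have toA_w : ∀ {W W' : Over (⟨U.left⟩ : PullbackCat F)} (m : W ⟶ W'),
      m.left.1 ≫ (toA W').hom = (toA W).hom := by
    intro W W' m
    show m.left.1 ≫ W'.hom.1 ≫ U.hom = W.hom.1 ≫ U.hom
    rw [← Category.assoc]
    exact congrArg (· ≫ U.hom) (congrArg InducedWideCategory.Hom.hom (Over.w m))
  let β : T ⋙ G ≅ T ⋙ G := NatIso.ofComponents (fun W => α.app (toA W)) (by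
    intro W W' m
    exact α.hom.naturality (X := toA W) (Y := toA W') (Over.homMk m.left.1 (toA_w m)))
  -- DESCEND `β` along the equivalence `T` to an automorphism `β'` of `D_{X_D} → D`
  let e := T.asEquivalence
  let W : (Over _ ⥤ D) ⥤ (Over (⟨U.left⟩ : PullbackCat F) ⥤ D) := (e.congrLeft (E := D)).inverse
  let hW : W.FullyFaithful := (e.congrLeft (E := D)).fullyFaithfulInverse
  let β' : Aut G := hW.preimageIso β
  have hββ' : W.mapIso β' = β := hW.isoEquiv.apply_symm_apply β
  have hβ'app : ∀ W₁ : Over (⟨U.left⟩ : PullbackCat F), β'.hom.app (T.obj W₁) = β.hom.app W₁ := fun W₁ => by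
    have := congrArg (fun i : T ⋙ G ≅ T ⋙ G => i.hom.app W₁) hββ'
    exact this
  -- `β'` acts trivially on `Φ`: at objects `T W₁` these are components of `α` …
  have hfixT : ∀ (W₁ : Over (⟨U.left⟩ : PullbackCat F)) (x : Φ.obj (op (G.obj (T.obj W₁)))),
      Frobenioids.pull Φ (β'.hom.app (T.obj W₁)) x = x := by
    intro W₁ x
    rw [hβ'app]
    exact hα (toA W₁) x
  -- … and every object of `D_{X_D}` is isomorphic to some `T W₁`
  have hfix : ∀ (V : Over ((wideSubcategoryInclusion (pullbackMorphisms F) ⋙ baseFunctor F).obj ⟨U.left⟩))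
      (x : Φ.obj (op (G.obj V))), Frobenioids.pull Φ (β'.hom.app V) x = x := by
    intro V x
    let W₁ := T.objPreimage V
    let i : T.obj W₁ ≅ V := T.objObjPreimageIso V
    have hn : G.map i.inv ≫ β'.hom.app (T.obj W₁) = β'.hom.app V ≫ G.map i.inv := β'.hom.naturality i.inv
    have hi : G.map i.inv ≫ G.map i.hom = 𝟙 _ := by
      rw [← G.map_comp, i.inv_hom_id, G.map_id]
    have h1 : β'.hom.app V = (G.map i.inv ≫ β'.hom.app (T.obj W₁)) ≫ G.map i.hom := by
      rw [hn, Category.assoc, hi, Category.comp_id]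
    rw [h1, Frobenioids.pull_comp, Frobenioids.pull_comp, hfixT, ← Frobenioids.pull_comp, hi,
      Frobenioids.pull_id]
  have hβ' : β' = 1 := hD.eq_one _ β' hfix
  have hβ : β = Iso.refl _ := by
    rw [← hββ', hβ']
    ext p
    rfl
  -- evaluate at the identity of `X` and transport along `toA W₀ → U` (as in Prop. 1.13 (i))
  let W₀ : Over (⟨U.left⟩ : PullbackCat F) :=
    Over.mk (Y := (⟨U.left⟩ : PullbackCat F)) (𝟙 (⟨U.left⟩ : PullbackCat F))
  set a₀ : baseObj F U.left ⟶ baseObj F U.left := α.hom.app (toA W₀) with ha₀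
  have h₀ : a₀ = 𝟙 _ := congrArg (fun i : T ⋙ G ≅ T ⋙ G => i.hom.app W₀) hβ
  let m₀ : toA W₀ ⟶ U := Over.homMk (𝟙 U.left) (by
    show 𝟙 U.left ≫ U.hom = 𝟙 U.left ≫ U.hom
    rfl)
  set a : baseObj F U.left ⟶ baseObj F U.left := α.hom.app U with ha
  have hn : Base F (𝟙 U.left) ≫ a = a₀ ≫ Base F (𝟙 U.left) := α.hom.naturality m₀
  rw [base_id, Category.id_comp, Category.comp_id] at hn
  rw [hn, h₀]
  rfl

/-- "Div-rigidity" of `C → D` over a Div-slim base (FrdI proof of Cor. 4.11 (i) p. 93 / (iv) p. 94): an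
automorphism of the functor `C → D` all of whose components act trivially on the divisor monoids is the
identity. [cite: MochizukiFrdI2008, Cor. 4.11 (iv) p.94] -/
theorem baseFunctor_iso_eq_refl_of_isDivSlim (hF : IsFrobenioid F)
    (hD : (PreFrobenioidData.ofFunctor Φ F).IsDivSlim) (α : baseFunctor F ≅ baseFunctor F)
    (hα : ∀ (A : C) (x : Φ.obj (op (baseObj F A))), Frobenioids.pull Φ (α.hom.app A) x = x) :
    α = Iso.refl _ := by
  ext X
  exact app_eq_id_of_iso_sliceBase_of_isDivSlim hF hD (Functor.isoWhiskerLeft (Over.forget X) α)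
    (fun U x => hα U.left x) (Over.mk (𝟙 X))

/-- By Def. 1.3 (iii)(d) every `x ∈ Φ(A_D)` is the divisor of a (co-angular pre-step) arrow out of `A`; so an
endomorphism of `A_D` fixing the divisors of all arrows out of `A` acts trivially on `Φ(A_D)`.
[cite: MochizukiFrdI2008, Def. 1.3 (iii) p.24] -/
theorem pull_eq_self_of_pull_div_eq (hF : IsFrobenioid F) {A : C} (a : baseObj F A ⟶ baseObj F A)
    (h : ∀ ⦃B : C⦄ (φ : A ⟶ B), Frobenioids.pull Φ a (Div F φ) = Div F φ)
    (x : Φ.obj (op (baseObj F A))) : Frobenioids.pull Φ a x = x := by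
  obtain ⟨B, φ, -, hφ⟩ := hF.iii_d_under_surj A x
  rw [← hφ]
  exact h φ

section Equivalence

variable {C₁ : Type u₁} [Category.{v₁} C₁]

/-- Div-rigidity of `Ψ ⋙ (C₂ → D₂)` for an equivalence `Ψ : C₁ ⥲ C₂` into a Frobenioid over a Div-slim base:
an automorphism whose components fix the divisors of (the images of) all arrows out of each object is the
identity — the first clause of the typed `Cor411ivRigid` (v2) ("each of the composite functors … is
rigid", FrdI Cor. 4.11 (iv) p. 92, proof p. 94 "via the same argument as … (i)").
[cite: MochizukiFrdI2008, Cor. 4.11 (iv) p.94] -/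
theorem comp_baseFunctor_iso_eq_refl_of_isDivSlim (Ψ : C₁ ≌ C) (hF : IsFrobenioid F)
    (hD : (PreFrobenioidData.ofFunctor Φ F).IsDivSlim)
    (α : Ψ.functor ⋙ baseFunctor F ≅ Ψ.functor ⋙ baseFunctor F)
    (hα : ∀ ⦃A B : C₁⦄ (φ : A ⟶ B),
      Frobenioids.pull Φ (α.hom.app A) (Div F (Ψ.functor.map φ)) = Div F (Ψ.functor.map φ)) :
    α = Iso.refl _ := by
  -- descend `α` along `Ψ` to an automorphism `α'` of `C₂ → D₂`
  let W : (C ⥤ D) ⥤ (C₁ ⥤ D) := (Ψ.congrLeft (E := D)).inverse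
  let hW : W.FullyFaithful := (Ψ.congrLeft (E := D)).fullyFaithfulInverse
  let α' : baseFunctor F ≅ baseFunctor F := hW.preimageIso α
  have hαα' : W.mapIso α' = α := hW.isoEquiv.apply_symm_apply α
  have hα'app : ∀ A : C₁, α'.hom.app (Ψ.functor.obj A) = α.hom.app A := fun A => by
    have := congrArg (fun i : Ψ.functor ⋙ baseFunctor F ≅ Ψ.functor ⋙ baseFunctor F => i.hom.app A) hαα'
    exact this
  -- `α'` acts trivially on `Φ` at the objects `Ψ A` …
  have hfixΨ : ∀ (A : C₁) (x : Φ.obj (op (baseObj F (Ψ.functor.obj A)))),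
      Frobenioids.pull Φ (α'.hom.app (Ψ.functor.obj A)) x = x := by
    intro A
    apply pull_eq_self_of_pull_div_eq hF
    intro B ψ
    -- `ψ ≫ ε_B⁻¹ = Ψ φ` for some `φ : A → Ψ⁻¹ B`; the divisors agree since `ε_B⁻¹` is an isomorphism
    let i : Ψ.functor.obj (Ψ.inverse.obj B) ≅ B := Ψ.counitIso.app B
    let φ : A ⟶ Ψ.inverse.obj B := Ψ.functor.preimage (ψ ≫ i.inv)
    have hφ : Ψ.functor.map φ = ψ ≫ i.inv := Ψ.functor.map_preimage _
    have h1 : Div F i.inv = 1 := isIsometry_of_isIso F hF.isPreFrobenioid i.inv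
    have h2 : degFr F i.inv = 1 := degFr_iso_hom F i.symm
    have hdiv : Div F (Ψ.functor.map φ) = Div F ψ := by
      rw [hφ, div_comp, h1, map_one, one_mul, h2, PNat.one_coe, pow_one]
    have key : Frobenioids.pull Φ (α.hom.app A) (Div F ψ) = Div F ψ := by
      have := hα φ
      rwa [hdiv] at this
    exact (congrArg (fun y => Frobenioids.pull Φ y (Div F ψ)) (hα'app A)).trans key
  -- … hence everywhere (transport along the counit `Ψ Ψ⁻¹ B ≅ B`)
  have hfix : ∀ (B : C) (x : Φ.obj (op ((baseFunctor F).obj B))),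
      Frobenioids.pull Φ (α'.hom.app B) x = x := by
    intro B x
    let i : Ψ.functor.obj (Ψ.inverse.obj B) ≅ B := Ψ.counitIso.app B
    have hn : (baseFunctor F).map i.inv ≫ α'.hom.app (Ψ.functor.obj (Ψ.inverse.obj B)) =
        α'.hom.app B ≫ (baseFunctor F).map i.inv := α'.hom.naturality i.inv
    have hi : (baseFunctor F).map i.inv ≫ (baseFunctor F).map i.hom = 𝟙 _ := by
      rw [← Functor.map_comp, i.inv_hom_id, CategoryTheory.Functor.map_id]
    have h1 : α'.hom.app B =
        ((baseFunctor F).map i.inv ≫ α'.hom.app (Ψ.functor.obj (Ψ.inverse.obj B))) ≫ (baseFunctor F).map i.hom := by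
      rw [hn, Category.assoc, hi, Category.comp_id]
    rw [h1, Frobenioids.pull_comp, Frobenioids.pull_comp, hfixΨ, ← Frobenioids.pull_comp, hi,
      Frobenioids.pull_id]
  have hα' : α' = Iso.refl _ := baseFunctor_iso_eq_refl_of_isDivSlim hF hD α' hfix
  rw [← hαα', hα']
  rfl

end Equivalence

end PreFrobenioid

end Literature.AlgebraicGeometry.Frobenioids
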